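import Summits.NavierStokesRegularity.FluidComputer.BlockReadout

/-!
# Fourier-block design: the two-mode BACKSCATTER triad vanishes identically (frequency bookkeeping)

HONEST FRAMING (cell `pub-fluidc`, verbatim): *low prior, high value-of-information experiment on
Tao's machine paradigm; NOT a claim that NS blows up.*

[folklore] Littlewood–Paley bookkeeping for Tao's wavelet data `CascadeWaveletData 1 m` (ε₀ = 1:
profile `ψᵢ` with real Fourier transform supported on `Bᵢ ∪ -Bᵢ`, `Bᵢ` an open ball inside the
shell `{1 < |ξ| ≤ 3/2}`): the ball has radius at most `1/4` (`radius_le_quarter`), so two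
frequencies of the SAME profile differ by less than `1/2` (`norm_sub_lt_half`); consequently, for
`ξ₁, ξ₂` in the frequency region of the mode `(i, n+1)` the frequency `-ξ₁ - ξ₂` is never in the
region of the mode `(i, n)` (`not_mem_freqRegion_of_add`: same half ⇒ `|ξ₁ + ξ₂| > 3·2ⁿ`, opposite
halves ⇒ `|ξ₁ + ξ₂| < 2ⁿ`, while the region of `(i, n)` lies in `2ⁿ < |ξ| ≤ (3/2)·2ⁿ`), and the
Euler triad `⟨B(ψ_{i,n+1}, ψ_{i,n+1}), ψ_{i,n}⟩` (Tao's (1.3), accepted `eulerForm`) VANISHES: its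
Fourier integrand is zero almost everywhere (`eulerForm_cascadeWavelet_succ_succ_eq_zero`; for the
design modes of `BlockReadout`, `eulerForm_mode_succ_succ_self`).

READING (honest). In the two-mode Galerkin truncation of Navier–Stokes on `span{ψ_n, ψ_{n+1}}`
the BACKSCATTER coefficient `κ'_n = Re⟨B(ψ_{n+1}, ψ_{n+1}), ψ_n⟩` is therefore `0` for EVERY
admissible wavelet datum of this class — not a constraint on the design and not a selection rule:
the pinned field of the re-typed local layer is the viscously damped gate field with NO backscatter
term. This corrects the expectation recorded by the lane (ASSEMBLY §2g.9(p)(q)) that `κ'_n = 0`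
"presumably fails for a generic pair". No design claim, no residue, no statement about
Navier–Stokes.

## References

* T. Tao, *Finite time blowup for an averaged three-dimensional Navier–Stokes equation*, J. Amer.
  Math. Soc. 29 (2016), (1.3) and §4, Lemma 4.1. [Tao2016AveragedNS]
-/

noncomputable section

open MeasureTheory Set Filter Topology Metric
open scoped ENNReal NNReal SchwartzMap

namespace Summit.NavierStokesRegularity.FluidComputer

open Literature.Analysis.FluidPDE.Tao2016
open Literature.Analysis.FluidPDE.FluidComputer

namespace BlockDesign

local notation "ℝ³" => EuclideanSpace ℝ (Fin 3)
local notation "ℂ³" => EuclideanSpace ℂ (Fin 3)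

section Support

variable {m : ℕ} (𝒟 : CascadeWaveletData 1 m)

/-- A ball inside the shell `{1 < |ξ| ≤ 3/2}` has radius at most `1/4` (the two points
`(1 ± 1/(4|c|)) c` of a larger ball centred at `c` would have norms `|c| ± 1/4`, both in
`(1, 3/2]`). [folklore] -/
theorem radius_le_quarter (i : Fin m) : 𝒟.radius i ≤ 1 / 4 := by
  by_contra h
  rw [not_le] at h
  have hr : 0 < 𝒟.radius i := lt_trans (by norm_num) h
  have hc1 : 1 < ‖𝒟.center i‖ := (𝒟.ball_subset i (mem_ball_self hr)).1
  have hc0 : 0 < ‖𝒟.center i‖ := by linarith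
  set a : ℝ := 1 / (4 * ‖𝒟.center i‖) with ha
  have ha0 : 0 < a := by positivity
  have hac : a * ‖𝒟.center i‖ = 1 / 4 := by
    rw [ha]; field_simp
  have hplus : (1 + a) • 𝒟.center i ∈ ball (𝒟.center i) (𝒟.radius i) := by
    rw [mem_ball, dist_eq_norm, add_smul, one_smul, add_sub_cancel_left, norm_smul,
      Real.norm_of_nonneg ha0.le, hac]
    exact h
  have hminus : (1 - a) • 𝒟.center i ∈ ball (𝒟.center i) (𝒟.radius i) := by
    rw [mem_ball, dist_eq_norm, sub_smul, one_smul, sub_sub_cancel_left, norm_neg, norm_smul,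
      Real.norm_of_nonneg ha0.le, hac]
    exact h
  have h1 := (𝒟.ball_subset i hplus).2
  have h2 := (𝒟.ball_subset i hminus).1
  have ha1 : a < 1 := by
    have : a * ‖𝒟.center i‖ < 1 * ‖𝒟.center i‖ := by rw [hac]; linarith
    exact lt_of_mul_lt_mul_right this hc0.le
  rw [norm_smul, Real.norm_of_nonneg (by linarith : (0 : ℝ) ≤ 1 + a), add_mul, one_mul, hac] at h1
  rw [norm_smul, Real.norm_of_nonneg (by linarith : (0 : ℝ) ≤ 1 - a), sub_mul, one_mul, hac] at h2
  linarith

/-- Two frequencies of the same profile ball differ by less than `1/2`. [folklore] -/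
theorem norm_sub_lt_half (i : Fin m) {η η' : ℝ³} (h : η ∈ ball (𝒟.center i) (𝒟.radius i))
    (h' : η' ∈ ball (𝒟.center i) (𝒟.radius i)) : ‖η - η'‖ < 1 / 2 := by
  rw [mem_ball] at h h'
  have ht := dist_triangle_right η η' (𝒟.center i)
  rw [← dist_eq_norm]
  linarith [radius_le_quarter 𝒟 i]

/-- **No same-profile triad `(n+1, n+1) → n`**: if `ξ₁, ξ₂` lie in the frequency region
`2^{n+1}(Bᵢ ∪ -Bᵢ)` of the mode `(i, n+1)`, then `-ξ₁ - ξ₂` does not lie in the region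
`2ⁿ(Bᵢ ∪ -Bᵢ)` of the mode `(i, n)`: with `ηⱼ = 2^{-(n+1)} ξⱼ`, either `η₁, η₂` are in the same
half, `|η₁ - η₂| < 1/2` and `|η₁ + η₂| > 2 - 1/2`, so `|ξ₁ + ξ₂| > 3·2ⁿ ≥ (3/2)·2ⁿ`; or they are in
opposite halves, `|η₁ + η₂| < 1/2`, so `|ξ₁ + ξ₂| < 2ⁿ`. [cite: Tao2016AveragedNS, Lemma 4.1] -/
theorem not_mem_freqRegion_of_add (i : Fin m) (n : ℤ) {ξ₁ ξ₂ : ℝ³}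
    (h₁ : ξ₁ ∈ freqRegion 𝒟 i (n + 1)) (h₂ : ξ₂ ∈ freqRegion 𝒟 i (n + 1)) :
    -ξ₁ - ξ₂ ∉ freqRegion 𝒟 i n := by
  intro h
  obtain ⟨hlo, hhi⟩ := 𝒟.norm_of_mem_freqRegion two_pos' i n h
  have hη₁ := (𝒟.norm_of_mem_ball_or i ((𝒟.mem_freqRegion_iff i (n + 1) ξ₁).1 h₁)).1
  rw [𝒟.mem_freqRegion_iff] at h₁ h₂
  set s : ℝ := (1 + 1) ^ (n + 1) with hs
  have hs0 : 0 < s := zpow_pos two_pos' _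
  have hs2 : s = 2 * (1 + 1) ^ n := by rw [hs, zpow_add_one₀ two_pos'.ne']; ring
  have hpn : (0 : ℝ) < (1 + 1) ^ n := zpow_pos two_pos' _
  set η₁ : ℝ³ := s⁻¹ • ξ₁ with hη₁def
  set η₂ : ℝ³ := s⁻¹ • ξ₂ with hη₂def
  have e1 : ξ₁ = s • η₁ := by rw [hη₁def, smul_smul, mul_inv_cancel₀ hs0.ne', one_smul]
  have e2 : ξ₂ = s • η₂ := by rw [hη₂def, smul_smul, mul_inv_cancel₀ hs0.ne', one_smul]
  have hnorm : ‖-ξ₁ - ξ₂‖ = s * ‖η₁ + η₂‖ := by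
    rw [e1, e2, show -(s • η₁) - s • η₂ = -(s • (η₁ + η₂)) by rw [smul_add]; abel, norm_neg,
      norm_smul, Real.norm_of_nonneg hs0.le]
  rw [hnorm] at hlo hhi
  -- `|η₁ + η₂| ≥ 2|η₁| - |η₁ - η₂|`
  have htri : 2 * ‖η₁‖ - ‖η₁ - η₂‖ ≤ ‖η₁ + η₂‖ := by
    have h2 : (2 : ℝ) • η₁ = (η₁ + η₂) + (η₁ - η₂) := by rw [two_smul]; abel
    have := norm_add_le (η₁ + η₂) (η₁ - η₂)
    rw [← h2, norm_smul, Real.norm_of_nonneg zero_le_two] at this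
    linarith
  have hneg : ∀ {x y : ℝ³}, ‖-x - -y‖ = ‖x - y‖ := fun {x y} => by
    rw [← norm_neg, show -(-x - -y) = x - y by abel]
  rcases h₁ with h₁ | h₁ <;> rcases h₂ with h₂ | h₂
  · -- same half
    have hd := norm_sub_lt_half 𝒟 i h₁ h₂
    have hsum : 3 / 2 < ‖η₁ + η₂‖ := by linarith
    have h3 : s * (3 / 2) < s * ‖η₁ + η₂‖ := mul_lt_mul_of_pos_left hsum hs0
    rw [hs2] at h3 hhi
    nlinarith
  · -- opposite halves: `|η₁ - (-η₂)| < 1/2`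
    have hd := norm_sub_lt_half 𝒟 i h₁ h₂
    rw [sub_neg_eq_add] at hd
    nlinarith
  · have hd := norm_sub_lt_half 𝒟 i h₂ h₁
    rw [sub_neg_eq_add, add_comm] at hd
    nlinarith
  · have hd := norm_sub_lt_half 𝒟 i h₁ h₂
    rw [hneg] at hd
    have hsum : 3 / 2 < ‖η₁ + η₂‖ := by linarith
    have h3 : s * (3 / 2) < s * ‖η₁ + η₂‖ := mul_lt_mul_of_pos_left hsum hs0
    rw [hs2] at h3 hhi
    nlinarith

/-- `Λ` vanishes when its first argument does. [cite: Tao2016AveragedNS, (1.4)] -/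
theorem Λ_zero_fst (ξ₁ ξ₂ : ℝ³) (X₂ X₃ : ℂ³) : Λ ξ₁ ξ₂ 0 X₂ X₃ = 0 := by
  simp [Λ, cdot]

/-- `Λ` vanishes when its second argument does. [cite: Tao2016AveragedNS, (1.4)] -/
theorem Λ_zero_snd (ξ₁ ξ₂ : ℝ³) (X₁ X₃ : ℂ³) : Λ ξ₁ ξ₂ X₁ 0 X₃ = 0 := by
  simp [Λ, cdot]

/-- `Λ` vanishes when its third argument does. [cite: Tao2016AveragedNS, (1.4)] -/
theorem Λ_zero_thd (ξ₁ ξ₂ : ℝ³) (X₁ X₂ : ℂ³) : Λ ξ₁ ξ₂ X₁ X₂ 0 = 0 := by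
  simp [Λ, cdot]

/-- The shear `(ξ₁, ξ₂) ↦ -ξ₁ - ξ₂` is quasi-measure-preserving (`ℝ³ × ℝ³ → ℝ³`,
Lebesgue). [folklore] -/
theorem quasiMeasurePreserving_neg_sub :
    Measure.QuasiMeasurePreserving (fun p : ℝ³ × ℝ³ => -p.1 - p.2) volume volume := by
  have ha : Measure.QuasiMeasurePreserving (fun p : ℝ³ × ℝ³ => p.1 + p.2)
      ((volume : Measure ℝ³).prod volume) volume :=
    quasiMeasurePreserving_add volume volume
  have hn : Measure.QuasiMeasurePreserving (Neg.neg : ℝ³ → ℝ³) volume volume :=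
    quasiMeasurePreserving_neg volume
  have e : (fun p : ℝ³ × ℝ³ => -p.1 - p.2) = Neg.neg ∘ fun p : ℝ³ × ℝ³ => p.1 + p.2 := by
    funext p
    simp only [Function.comp_apply, neg_add']
  rw [e]
  exact hn.comp ha

/-- **The same-profile backscatter triad vanishes**:
`⟨B(ψ_{i,n+1}, ψ_{i,n+1}), ψ_{i,n}⟩ = 0` for every wavelet datum of `CascadeWaveletData 1 m`,
every profile `i` and every scale `n` — the Fourier integrand of Tao's (1.3) is zero almost
everywhere by `not_mem_freqRegion_of_add` and the frequency localisation of the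
wavelets. [cite: Tao2016AveragedNS, (1.3) + Lemma 4.1] -/
theorem eulerForm_cascadeWavelet_succ_succ_eq_zero (i : Fin m) (n : ℤ) :
    eulerForm (cascadeWavelet 1 (𝒟.ψ i) (n + 1)) (cascadeWavelet 1 (𝒟.ψ i) (n + 1))
      (cascadeWavelet 1 (𝒟.ψ i) n) = 0 := by
  unfold eulerForm
  have hf := 𝒟.fourierFn_cascadeWavelet_eq_zero two_pos' i (n + 1)
  have hg := 𝒟.fourierFn_cascadeWavelet_eq_zero two_pos' i n
  have h1 : ∀ᵐ p : ℝ³ × ℝ³, p.1 ∉ freqRegion 𝒟 i (n + 1) →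
      fourierFn (cascadeWavelet 1 (𝒟.ψ i) (n + 1)) p.1 = 0 :=
    (Measure.quasiMeasurePreserving_fst (μ := (volume : Measure ℝ³))
      (ν := (volume : Measure ℝ³))).ae hf
  have h2 : ∀ᵐ p : ℝ³ × ℝ³, p.2 ∉ freqRegion 𝒟 i (n + 1) →
      fourierFn (cascadeWavelet 1 (𝒟.ψ i) (n + 1)) p.2 = 0 :=
    (Measure.quasiMeasurePreserving_snd (μ := (volume : Measure ℝ³))
      (ν := (volume : Measure ℝ³))).ae hf
  have h3 : ∀ᵐ p : ℝ³ × ℝ³, -p.1 - p.2 ∉ freqRegion 𝒟 i n →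
      fourierFn (cascadeWavelet 1 (𝒟.ψ i) n) (-p.1 - p.2) = 0 :=
    quasiMeasurePreserving_neg_sub.ae hg
  rw [integral_eq_zero_of_ae, mul_zero]
  filter_upwards [h1, h2, h3] with p k1 k2 k3
  by_cases c1 : p.1 ∈ freqRegion 𝒟 i (n + 1)
  · by_cases c2 : p.2 ∈ freqRegion 𝒟 i (n + 1)
    · rw [k3 (not_mem_freqRegion_of_add 𝒟 i n c1 c2), Λ_zero_thd]
      rfl
    · rw [k2 c2, Λ_zero_snd]
      rfl
  · rw [k1 c1, Λ_zero_fst]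
    rfl

end Support

section Modes

variable (𝒟 : CascadeWaveletData 1 1)

/-- For the design modes of `BlockReadout` (`ψ_k = ψ_{0,k}`):
`⟨B(ψ_{n+1}, ψ_{n+1}), ψ_n⟩ = 0` — the two-mode BACKSCATTER coefficient of every admissible
design vanishes identically. [cite: Tao2016AveragedNS, (1.3) + Lemma 4.1] -/
theorem eulerForm_mode_succ_succ_self (n : ℕ) :
    eulerForm (mode 𝒟 (n + 1)) (mode 𝒟 (n + 1)) (mode 𝒟 n) = 0 := by
  have h := eulerForm_cascadeWavelet_succ_succ_eq_zero 𝒟 0 (n : ℤ)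
  simpa [mode, Nat.cast_succ] using h

/-- Real-part form: `Re⟨B(ψ_{n+1}, ψ_{n+1}), ψ_n⟩ = 0` (this is the lane's backscatter
coefficient `backCoef`). [cite: Tao2016AveragedNS, (1.3) + Lemma 4.1] -/
theorem re_eulerForm_mode_succ_succ_self (n : ℕ) :
    (eulerForm (mode 𝒟 (n + 1)) (mode 𝒟 (n + 1)) (mode 𝒟 n)).re = 0 := by
  rw [eulerForm_mode_succ_succ_self, Complex.zero_re]

end Modes

end BlockDesign

end Summit.NavierStokesRegularity.FluidComputer
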